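import Summits.CriticalPhenomena.PercolationContinuityZ3.Theorems.PercNearOneGluingNoHeavyLowerTailKNGoodSplitRows
import Summits.CriticalPhenomena.PercolationContinuityZ3.Theorems.PercNearOneGluingNoHeavyLowerTailKNGoodOneLayerGC
import HarnessLib

/-!
# Kozma–Nitzan goodness for an observer with two pendant TWO-PORT star children on disjoint ports, over an ARBITRARY core
# (`NoHeavyLowerTail` cell, stmt-CriticalPhenomena-4575; prover `prim-hp-2`, deletion–contraction line, gen 8)

Support file (`--supports stmt-CriticalPhenomena-4575`).  No definitions, no named facts, no sorries.
Memos: `run/shared/lean/prim/prim-hp-2/MEMO-gen6-gc-formal-corner.md` (GC face of the `2+2` cell), lead `KERNEL-BETA-R-TORUS.md`, lf-3 `LF3-BETA-R.md`.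

THEOREM `KNGoodTwoTwo.knGood_twoPendantTwoPortStars`.  Let `o ∉ A` be an observer whose neighbours are relays (hairs, free) and two Steiner
vertices `x, y ∉ A`; `x` is a pendant star with exactly the two ports `p₁ ≠ p₂ ∈ A` (hairs in `(0,1)`), `y` a pendant star with the two ports
`q₁ ≠ q₂ ∈ A`, `{p₁,p₂} ∩ {q₁,q₂} = ∅`; the rest of the graph — the core on `A`, `b` and any further vertices — is ARBITRARY.  Then
`(G, A, o, b)` is good in the sense of Kozma–Nitzan (§3.2): `μ(o ↔ b) ≥ min_a μ(a ↔ b) − Σ_{W ∩ A = ∅} μ(C(o) = W)·min_a μ_{G∖W}(a ↔ b)`.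
This is the cell's "two lonely children" kernel (lead LEAD-GEN7 §3a, configuration (β) with linked ports and any core) at GOODNESS strength.

Assembly: relay hairs at `o` are free (`KNGoodHair.knGood_of_deleteHairs`); the series step `KNGoodSeries.knGood_series_of_gluing` needs
goodness of `x` and `y` in `G − o` (Kozma–Nitzan Thm. 4) and the gluing inequality GC for the witness `a₀ = argmin_{G−o} μ(· ↔ b)`; GC is moved to
the one-layer observer `y` carrying all four hairs (`agood_hairTransfer`), where it is `agood_oneLayer_twoTwo_nonneg` fed with the split rows of
`a₀` (`real_openConn_split_twoStars`: in `G − o` every relay reliability is the four-term mixture over the glued cores).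
-/

namespace Summit.CriticalPhenomena.PercolationContinuityZ3.Theorems

open MeasureTheory Set ProbabilityTheory Literature.Probability.LatticeModels Literature.Probability.Percolation

noncomputable section
open Classical

namespace KNGoodTwoTwo
open UpsetExchange KNGoodAux KNGoodSeries KNGoodHair KNGoodSeriesEasy RelayNbhd

variable {n : ℕ}

/-- **Goodness for `o` + relay hairs + two pendant two-port stars on disjoint ports, over an arbitrary core.**  See the module docstring.
[cite: KozmaNitzan2024, §3.2 Definition (p. 12), Thm. 4–5 and Lemma 5 (pp. 12–14), Lemma 4 (p. 7), Question 9 (p. 36); VandenbergHaggstromKahn2005, Thm. 1.2] -/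
theorem knGood_twoPendantTwoPortStars (w : Sym2 (Fin n) → unitInterval) (A : Finset (Fin n)) (hA : A.Nonempty)
    (o x y b p₁ p₂ q₁ q₂ : Fin n) (ho : o ∉ A) (hx : x ∉ A) (hy : y ∉ A) (hxo : x ≠ o) (hyo : y ≠ o) (hxy : x ≠ y)
    (hbo : b ≠ o) (hbx : b ≠ x) (hby : b ≠ y)
    (hp₁ : p₁ ∈ A) (hp₂ : p₂ ∈ A) (hq₁ : q₁ ∈ A) (hq₂ : q₂ ∈ A)
    (hp : p₁ ≠ p₂) (hq : q₁ ≠ q₂) (h11 : p₁ ≠ q₁) (h12 : p₁ ≠ q₂) (h21 : p₂ ≠ q₁) (h22 : p₂ ≠ q₂)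
    (hoN : ∀ v : Fin n, v ≠ o → v ∉ A → v ≠ x → v ≠ y → w s(o, v) = 0)
    (hxN : ∀ z : Fin n, z ≠ p₁ → z ≠ p₂ → z ≠ o → w s(x, z) = 0)
    (hyN : ∀ z : Fin n, z ≠ q₁ → z ≠ q₂ → z ≠ o → w s(y, z) = 0)
    (hh₁ : 0 < (w s(x, p₁) : ℝ)) (hh₁' : (w s(x, p₁) : ℝ) < 1) (hh₂ : 0 < (w s(x, p₂) : ℝ)) (hh₂' : (w s(x, p₂) : ℝ) < 1)
    (hk₁ : 0 < (w s(y, q₁) : ℝ)) (hk₁' : (w s(y, q₁) : ℝ) < 1) (hk₂ : 0 < (w s(y, q₂) : ℝ)) (hk₂' : (w s(y, q₂) : ℝ) < 1) :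
    KNGood w A hA o b := by
  haveI : ∀ v : Sym2 (Fin n) → unitInterval, IsProbabilityMeasure (prodBernoulli v) := fun v => inferInstance
  -- distinctness bookkeeping
  have hxp₁ : x ≠ p₁ := fun h => hx (h ▸ hp₁)
  have hxp₂ : x ≠ p₂ := fun h => hx (h ▸ hp₂)
  have hxq₁ : x ≠ q₁ := fun h => hx (h ▸ hq₁)
  have hxq₂ : x ≠ q₂ := fun h => hx (h ▸ hq₂)
  have hyp₁ : y ≠ p₁ := fun h => hy (h ▸ hp₁)
  have hyp₂ : y ≠ p₂ := fun h => hy (h ▸ hp₂)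
  have hyq₁ : y ≠ q₁ := fun h => hy (h ▸ hq₁)
  have hyq₂ : y ≠ q₂ := fun h => hy (h ▸ hq₂)
  have hp₁o : p₁ ≠ o := fun h => ho (h ▸ hp₁)
  have hp₂o : p₂ ≠ o := fun h => ho (h ▸ hp₂)
  have hq₁o : q₁ ≠ o := fun h => ho (h ▸ hq₁)
  have hq₂o : q₂ ≠ o := fun h => ho (h ▸ hq₂)
  have hPQ : s(p₁, p₂) ≠ s(q₁, q₂) := by
    intro h; rcases Sym2.eq_iff.1 h with ⟨h1, _⟩ | ⟨h1, _⟩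
    · exact h11 h1
    · exact h12 h1
  -- delete the relay hairs at `o`
  set w' : Sym2 (Fin n) → unitInterval := fun e => if ∃ q ∈ A, e = s(o, q) then 0 else w e with hw'
  refine knGood_of_deleteHairs w A hA o b ho ?_
  rw [← hw']
  have hpin : pinW w' {e : Sym2 (Fin n) | o ∈ e ∧ ¬ e.IsDiag} ∅ = pinW w {e : Sym2 (Fin n) | o ∈ e ∧ ¬ e.IsDiag} ∅ := by
    refine pinW_star_eq_of_eqOff w w' o fun e he => ?_
    rw [hw']; simp only
    rw [if_neg]
    rintro ⟨q, hq', rfl⟩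
    exact he ⟨Sym2.mem_mk_left o q, fun hd => ho ((Sym2.mk_isDiag_iff.1 hd) ▸ hq')⟩
  set u := pinW w {e : Sym2 (Fin n) | o ∈ e ∧ ¬ e.IsDiag} ∅ with hu
  have huoff : ∀ c d : Fin n, c ≠ o → d ≠ o → u s(c, d) = w s(c, d) := by
    intro c d hc hd
    have hmem : s(c, d) ∉ {e : Sym2 (Fin n) | o ∈ e ∧ ¬ e.IsDiag} := by
      rintro ⟨hoe, -⟩
      rcases Sym2.mem_iff.1 hoe with h | h
      · exact hc h.symm
      · exact hd h.symm
    rw [hu, pinW_apply_of_not_mem w ∅ hmem]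
  have huo : ∀ v : Fin n, v ≠ o → u s(v, o) = 0 := by
    intro v hv; rw [Sym2.eq_swap, hu]; exact pinW_star_mk w hv
  have hxNu : ∀ z : Fin n, z ≠ p₁ → z ≠ p₂ → u s(x, z) = 0 := by
    intro z h1 h2
    by_cases hzo : z = o
    · rw [hzo]; exact huo x hxo
    · rw [huoff x z hxo hzo]; exact hxN z h1 h2 hzo
  have hyNu : ∀ z : Fin n, z ≠ q₁ → z ≠ q₂ → u s(y, z) = 0 := by
    intro z h1 h2
    by_cases hzo : z = o
    · rw [hzo]; exact huo y hyo
    · rw [huoff y z hyo hzo]; exact hyN z h1 h2 hzo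
  have hux1 : u s(x, p₁) = w s(x, p₁) := huoff x p₁ hxo hp₁o
  have hux2 : u s(x, p₂) = w s(x, p₂) := huoff x p₂ hxo hp₂o
  have huy1 : u s(y, q₁) = w s(y, q₁) := huoff y q₁ hyo hq₁o
  have huy2 : u s(y, q₂) = w s(y, q₂) := huoff y q₂ hyo hq₂o
  -- goodness of the two children in `G − o` (Kozma–Nitzan, Thm. 4)
  have hgoodx : KNGood u A hA x b :=
    KozmaNitzan2024_thm4_good u A hA x b hx fun z _ hzA => hxNu z (fun h => hzA (h ▸ hp₁)) (fun h => hzA (h ▸ hp₂))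
  have hgoody : KNGood u A hA y b :=
    KozmaNitzan2024_thm4_good u A hA y b hy fun z _ hzA => hyNu z (fun h => hzA (h ▸ hq₁)) (fun h => hzA (h ▸ hq₂))
  -- the witness
  obtain ⟨a₀, ha₀, hmin⟩ := A.exists_min_image (fun a => (prodBernoulli u).real (openConn a b)) hA
  have ha₀x : a₀ ≠ x := fun h => hx (h ▸ ha₀)
  have ha₀y : a₀ ≠ y := fun h => hy (h ▸ ha₀)
  -- (A) hair transfer: GC is the goodness functional of the one-layer observer `y` with four ports
  set W₁ : Sym2 (Fin n) → unitInterval := fun f => if f = s(y, p₁) then u s(x, p₁) else if f = s(y, p₂) then u s(x, p₂)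
    else if x ∈ f then 0 else u f with hW₁
  have hT := agood_hairTransfer u A hA x y p₁ p₂ a₀ b hxy hxp₁ hxp₂ hyp₁ hyp₂ hp hp₁ hp₂ hx ha₀ hbx hxNu
    (hyNu p₁ h11 h12) (hyNu p₂ h21 h22)
  -- values of `W₁` at `y`
  have hne21 : s(y, p₂) ≠ s(y, p₁) := fun h => hp (Sym2.congr_right.1 h).symm
  have hWp₁ : W₁ s(y, p₁) = u s(x, p₁) := by rw [hW₁]; simp
  have hWp₂ : W₁ s(y, p₂) = u s(x, p₂) := by rw [hW₁]; simp [hp.symm, hyp₁]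
  have hWother : ∀ z : Fin n, z ≠ p₁ → z ≠ p₂ → z ≠ x → W₁ s(y, z) = u s(y, z) := by
    intro z h1 h2 h3
    have n1 : s(y, z) ≠ s(y, p₁) := fun h => h1 (Sym2.congr_right.1 h)
    have n2 : s(y, z) ≠ s(y, p₂) := fun h => h2 (Sym2.congr_right.1 h)
    have n3 : x ∉ s(y, z) := by
      intro h; rcases Sym2.mem_iff.1 h with h | h
      · exact hxy h
      · exact h3 h.symm
    rw [hW₁]; simp only; rw [if_neg n1, if_neg n2, if_neg n3]
  have hWq₁ : W₁ s(y, q₁) = w s(y, q₁) := by rw [hWother q₁ h11.symm h21.symm hxq₁.symm, huy1]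
  have hWq₂ : W₁ s(y, q₂) = w s(y, q₂) := by rw [hWother q₂ h12.symm h22.symm hxq₂.symm, huy2]
  have hiso : ∀ u' : Fin n, u' ≠ y → u' ∉ ({p₁, p₂, q₁, q₂} : Finset (Fin n)) → W₁ s(y, u') = 0 := by
    intro u' _ hu'
    simp only [Finset.mem_insert, Finset.mem_singleton, not_or] at hu'
    by_cases hux : u' = x
    · subst hux
      rw [hW₁]; simp [hxp₁, hxp₂, hxy]
    · rw [hWother u' hu'.1 hu'.2.1 hux]; exact hyNu u' hu'.2.2.1 hu'.2.2.2
  have hloop : W₁ s(y, y) = 0 := by rw [hWother y hyp₁ hyp₂ hxy.symm]; exact hyNu y hyq₁ hyq₂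
  -- the core and the split parameters
  set K : Sym2 (Fin n) → unitInterval := fun e => if y ∈ e then 0 else W₁ e with hK
  have hKK : K = fun e => if y ∈ e then 0 else if x ∈ e then 0 else u e := by
    funext e
    rw [hK]; simp only
    by_cases hye : y ∈ e
    · rw [if_pos hye, if_pos hye]
    · rw [if_neg hye, if_neg hye, hW₁]; simp only
      have n1 : e ≠ s(y, p₁) := fun h => hye (h ▸ Sym2.mem_mk_left _ _)
      have n2 : e ≠ s(y, p₂) := fun h => hye (h ▸ Sym2.mem_mk_left _ _)
      rw [if_neg n1, if_neg n2]
  set U : unitInterval := ⟨(w s(x, p₁) : ℝ) * w s(x, p₂), unitInterval.mul_mem (w s(x, p₁)).2 (w s(x, p₂)).2⟩ with hU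
  set V : unitInterval := ⟨(w s(y, q₁) : ℝ) * w s(y, q₂), unitInterval.mul_mem (w s(y, q₁)).2 (w s(y, q₂)).2⟩ with hV
  have hUval : (U : ℝ) = (w s(x, p₁) : ℝ) * w s(x, p₂) := rfl
  have hVval : (V : ℝ) = (w s(y, q₁) : ℝ) * w s(y, q₂) := rfl
  have hu' : (U : ℝ) = (W₁ s(y, p₁) : ℝ) * W₁ s(y, p₂) := by rw [hWp₁, hWp₂, hux1, hux2]
  have hv' : (V : ℝ) = (W₁ s(y, q₁) : ℝ) * W₁ s(y, q₂) := by rw [hWq₁, hWq₂]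
  obtain ⟨r, hrA, hrmin⟩ := A.exists_min_image (fun a => (prodBernoulli K).real (openConn a b)) hA
  -- (B) the split rows of the witness
  have hsplit : ∀ z : Fin n, z ≠ x → z ≠ y → (prodBernoulli u).real (openConn z b) =
      (1 - (U : ℝ)) * (1 - (V : ℝ)) * (prodBernoulli K).real (openConn z b) +
        (U : ℝ) * (1 - (V : ℝ)) * (prodBernoulli (fun f : Sym2 (Fin n) => if f = s(p₁, p₂) then 1 else K f)).real (openConn z b) +
        (1 - (U : ℝ)) * (V : ℝ) * (prodBernoulli (fun f : Sym2 (Fin n) => if f = s(q₁, q₂) then 1 else K f)).real (openConn z b) +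
        (U : ℝ) * (V : ℝ) *
          (prodBernoulli (fun f : Sym2 (Fin n) => if f = s(p₁, p₂) then 1 else if f = s(q₁, q₂) then 1 else K f)).real (openConn z b) := by
    intro z hzx hzy
    rw [hKK, hUval, hVval, ← hux1, ← hux2, ← huy1, ← huy2]
    exact real_openConn_split_twoStars u x y p₁ p₂ q₁ q₂ z b hxy hxp₁ hxp₂ hyq₁ hyq₂ hyp₁ hyp₂ hxq₁ hxq₂ hp hq hPQ
      hzx hzy hbx hby hxNu hyNu
  have hrow : ∀ z ∈ ({r, p₁, p₂, q₁, q₂} : Finset (Fin n)), 0 ≤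
      (1 - (U : ℝ)) * (1 - (V : ℝ)) * ((prodBernoulli K).real (openConn z b) - (prodBernoulli K).real (openConn a₀ b)) +
      (U : ℝ) * (1 - (V : ℝ)) * ((prodBernoulli (fun f : Sym2 (Fin n) => if f = s(p₁, p₂) then 1 else K f)).real (openConn z b) -
        (prodBernoulli (fun f : Sym2 (Fin n) => if f = s(p₁, p₂) then 1 else K f)).real (openConn a₀ b)) +
      (1 - (U : ℝ)) * (V : ℝ) * ((prodBernoulli (fun f : Sym2 (Fin n) => if f = s(q₁, q₂) then 1 else K f)).real (openConn z b) -
        (prodBernoulli (fun f : Sym2 (Fin n) => if f = s(q₁, q₂) then 1 else K f)).real (openConn a₀ b)) +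
      (U : ℝ) * (V : ℝ) * ((prodBernoulli (fun f : Sym2 (Fin n) => if f = s(p₁, p₂) then 1 else if f = s(q₁, q₂) then 1 else K f)).real (openConn z b) -
        (prodBernoulli (fun f : Sym2 (Fin n) => if f = s(p₁, p₂) then 1 else if f = s(q₁, q₂) then 1 else K f)).real (openConn a₀ b)) := by
    intro z hz
    have hzA : z ∈ A := by
      simp only [Finset.mem_insert, Finset.mem_singleton] at hz
      rcases hz with rfl | rfl | rfl | rfl | rfl <;> assumption
    have hzx : z ≠ x := fun h => hx (h ▸ hzA)
    have hzy : z ≠ y := fun h => hy (h ▸ hzA)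
    have hle := hmin z hzA
    rw [hsplit z hzx hzy, hsplit a₀ ha₀x ha₀y] at hle
    linarith
  -- (C) GC at the one-layer observer `y`
  have hB := agood_oneLayer_twoTwo_nonneg W₁ A hA y p₁ p₂ q₁ q₂ a₀ r b K hK U V hu' hv' hy hp₁ hp₂ hq₁ hq₂ hrA
    hp hq h11 h12 h21 h22 ha₀y hby hiso hloop
    (by rw [hWp₁, hux1]; exact hh₁) (by rw [hWp₁, hux1]; exact hh₁') (by rw [hWp₂, hux2]; exact hh₂) (by rw [hWp₂, hux2]; exact hh₂')
    (by rw [hWq₁]; exact hk₁) (by rw [hWq₁]; exact hk₁') (by rw [hWq₂]; exact hk₂) (by rw [hWq₂]; exact hk₂')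
    hrmin hrow
  have hGC : 0 ≤ (prodBernoulli (Function.update u s(x, y) 1)).real (openConn x b) -
      (prodBernoulli (Function.update u s(x, y) 1)).real (openConn a₀ b) +
      ∑ W ∈ nullSets A, (prodBernoulli (Function.update u s(x, y) 1)).real (clusterIs x W) *
        A.inf' hA (fun a' => (prodBernoulli (Function.update u s(x, y) 1)).real (openConnIn ((↑W : Set (Fin n))ᶜ) a' b)) := by
    rw [hT]; exact hB
  -- (D) the series step
  exact knGood_series_of_gluing w' A hA o x y a₀ b ho hxo hyo hxy ha₀ hbo
    (fun v hvo hvx hvy => by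
      rw [hw']; simp only
      by_cases hvA : v ∈ A
      · rw [if_pos ⟨v, hvA, rfl⟩]; rfl
      · rw [if_neg]
        · exact congrArg Subtype.val (hoN v hvo hvA hvx hvy)
        · rintro ⟨q, hq', hvq⟩
          exact hvA ((Sym2.congr_right.1 hvq) ▸ hq'))
    (by rw [hpin]; exact hmin) (by rw [hpin]; exact hgoodx) (by rw [hpin]; exact hgoody) (by rw [hpin]; linarith [hGC])

end KNGoodTwoTwo

end

end Summit.CriticalPhenomena.PercolationContinuityZ3.Theorems
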